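import Summits.BirchSwinnertonDyer.BirchSwinnertonDyer.Theorems.PrintCFramBottomClassIndexLawFiveLeBorelTopLayerHind
import HarnessLib

/-!
# Route `PrintCFram`, crux C2 `BottomClassIndexLawFiveLe` (stmt-BirchSwinnertonDyer-20372), line
# `eisenstein-resource-bdp-line`, stub `stub_kolyvaginUpper_borelCM_pairSum_offKrizLi`:
# **THE BOREL ČEBOTAREV REQUESTS BY SIGN** — FILE 7 with the per-member rule «sign `η`: any order ≤ ord;
# sign `−η`: orders ≤ `p^{⌊e/2⌋}`; or target `0`», and the shapes (B1), (B2) of the abstract Borel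
# descent (`…BorelDescentClaimA/B`) as theorems on `H¹(K, W[p^M])`
# (cell `bsd-print-cfram`, seat `bsd-line-cfram-p1-w2` g7; helper `--supports` 20372; 0 facts, 0 defs, 0 sorry)

HONEST FRAMING. Nothing about BSD is proved here, and nothing of the stub itself. FILE 7
(`exists_kolyvaginPrime_gt_pow_cebotarevShape_of_cmRamified`, w2 g6) prescribes local orders `p^{N_i}` at
Kolyvagin primes for a top-independent family of `c_*`-eigenclasses, but only for members whose sign matches
the parity of their OWN depth (`N_i ≠ 0 → ν_i = (−1)^{e_i−1}η`). FILE 6 (`…_orders_of_cmRamified`) shows that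
the right rule is per REQUESTED depth: a class of sign `η` admits every order `≤ p^{⌈e/2⌉} = ord` (request an
odd depth `2N−1 ≤ e`), a class of sign `−η` every order `≤ p^{⌊e/2⌋}` (even depth `2N ≤ e`). This file states
FILE 7 in that form and adds the request shapes of the abstract descent:

* `exists_kolyvaginPrime_gt_pow_requests_of_cmRamified` — FILE 7′: exponents `N_i` with, for each `i`,
  `N_i = 0` (target `0`) or `ν_i = η ∧ 2N_i ≤ e_i + 1` or `ν_i = −η ∧ 2N_i ≤ e_i`; same conclusion shape as
  `KolyvaginDescent.HypothesesM.cebotarev` (`p^{N_i} x_i ∈ ker loc_λ ∧ (N_i ≠ 0 → p^{N_i−1} x_i ∉ ker loc_λ)`).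
* `exists_kolyvaginPrime_gt_pow_requests_pair_of_opposite_sign` — **shape (B2)** of `…BorelDescentClaimA`
  (Claim A's `{y, s}`): two eigenclasses of OPPOSITE signs with exact positive depths, requests by the sign
  rule, NO independence hypothesis (`hind_pair_of_opposite_sign`, previous file).
* `exists_kolyvaginPrime_gt_pow_requests_single` — **shape (B1)** (one class, any sign).
* (NOT here) shape (B3) (`x ↦ 0`, an `η`-class `s`, a `(−η)`-class `w`) is FILE 7′ + `hind_of_hind_on_classes`
  GIVEN the independence of the tops of `x` and `s` when they share a parity — what the split (B4) delivers by
  integer subtraction; left to the successor file.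

All conditional on the named fact `chebotarev_artinRep` (as FILE 1/6/7). What separates these from the
displayed hypotheses `hceb1/2/3` of `…BorelDescentClaimA/B` is dictionary only (`A ℓ` = `torsionLocalKer` at
the place of `ℓ`, `Kol ℓ` = the Kolyvagin conditions printed in the conclusion, `dp` = an exact-depth
function, whose existence for every class is w2 g5's (α) + uniseriality). THEOREMS ONLY; no definition, no
named fact introduced, no `sorry`. BSD is not proved by any of this; no summit statement is proved by this
seat. Reference: [McCallumLMS1991] §3 Cor. 3.2.
-/

set_option autoImplicit false
-- `…BirchSwinnertonDyer.BirchSwinnertonDyer.Theorems…` is the problem's mandated namespace (D-0017).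
set_option linter.dupNamespace false

noncomputable section

open scoped Classical

namespace Summit.BirchSwinnertonDyer.BirchSwinnertonDyer.Theorems.PrintCFram.BorelKolyvaginPairing

open WeierstrassCurve NumberField IsDedekindDomain Field Literature.NumberTheory.EllipticCurves
  Literature.NumberTheory.GaloisRepresentations Literature.NumberTheory.EllipticCurves.Rank1Residual
  Summit.BirchSwinnertonDyer.BirchSwinnertonDyer.Theorems.PrintCFram.BorelHomothety

variable (W : WeierstrassCurve ℚ) [W.IsElliptic] (p : ℕ) [hp : Fact p.Prime]
variable {K : Type} [Field K] [NumberField K]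

/-- **FILE 7′ — the Borel `cebotarev` requests by sign.** `W` CM, `5 ≤ p` CM-ramified, `𝓞_𝔭`-structure
`(s, μ, m)`; `K` imaginary quadratic with complex conjugation `c` lifted along `c₀`; `η = ±1` the sign of `c₀` on
`ker μ`; `M ≥ 1`; `c_*`-eigenclasses `x_i` (signs `ν_i = ±1`) with values killed by `μ^{e_i}` and independent
top layers; exponents `N_i` such that for each `i`: `N_i = 0`, or `ν_i = η` and `2N_i ≤ e_i + 1` (any order up
to `ord = p^{⌈e_i/2⌉}`), or `ν_i = −η` and `2N_i ≤ e_i` (orders up to `p^{⌊e_i/2⌋}`). Then above every `b`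
there is a Kolyvagin prime `ℓ` of level `p^M` with `p^{N_i} x_i ∈ ker loc_λ` and
`N_i ≠ 0 → p^{N_i−1} x_i ∉ ker loc_λ` for every `i`. [cite: McCallumLMS1991, §3 Cor. 3.2] -/
theorem exists_kolyvaginPrime_gt_pow_requests_of_cmRamified
    (hC : Literature.NumberTheory.Automorphic.chebotarev_artinRep) {N : ℕ} [NeZero N]
    (hCM : W.HasCM) (h5 : 5 ≤ p) (hram : CMRamified W p)
    {s : AlgebraicClosure ℚ} {μ : AddMonoid.End W.geomPoints} {m : ℤ}
    (hs : s ^ 2 = ((-(p : ℤ) : ℤ) : AlgebraicClosure ℚ)) (hm : m.natAbs = p)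
    (hμμ : ∀ P, μ (μ P) = m • P)
    (hcomm : ∀ g : absoluteGaloisGroup ℚ, g • s = s → ∀ P, μ (g • P) = g • μ P)
    (hanti : ∀ g : absoluteGaloisGroup ℚ, g • s = -s → ∀ P, μ (g • P) = -(g • μ P))
    (hK : IsImaginaryQuadratic K) {M : ℕ} (hM : 1 ≤ M) {c : K ≃ₐ[ℚ] K}
    {c₀ : absoluteGaloisGroup ℚ} (hc₀ : IsComplexConjugation (Rat.castHom ℝ) c₀)
    (ht : IsLiftOfAut c (absGaloisTransport (K := ℚ) (L := K) c₀).toRingEquiv)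
    {η : ℤ} (hηs : η = 1 ∨ η = -1) (hη : ∀ P : W.geomPoints, μ P = 0 → c₀ • P = η • P)
    {ι : Type*} [Fintype ι] (xs : ι → galH1Torsion (W.baseChange K) ((p ^ M : ℕ) : ℤ))
    {ν : ι → ℤ} (hxs : ∀ i, conjAct W c ((p ^ M : ℕ) : ℤ) (xs i) = ν i • xs i) (e : ι → ℕ)
    (he : ∀ i, ∀ ρ ∈ torsionFixing (W.baseChange K) ((p ^ M : ℕ) : ℤ),
      (μ ^ e i) ((RatClosure.torsionEquiv (K := K) W ((p ^ M : ℕ) : ℤ)).symm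
        (h1Eval (W.baseChange K) ((p ^ M : ℕ) : ℤ) (xs i) ρ) : W.geomPoints) = 0)
    (hind : ∀ c : ι → ℤ,
      (∀ ρ ∈ torsionFixing (W.baseChange K) ((p ^ M : ℕ) : ℤ),
        ∑ i, c i • (μ ^ (e i - 1)) ((RatClosure.torsionEquiv (K := K) W ((p ^ M : ℕ) : ℤ)).symm
          (h1Eval (W.baseChange K) ((p ^ M : ℕ) : ℤ) (xs i) ρ) : W.geomPoints) = 0) →
        ∀ i, 0 < e i → (p : ℤ) ∣ c i)
    (Nv : ι → ℕ)
    (hreq : ∀ i, Nv i = 0 ∨ (ν i = η ∧ 2 * Nv i ≤ e i + 1) ∨ (ν i = -η ∧ 2 * Nv i ≤ e i)) (b : ℕ) :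
    ∃ ℓ : ℕ, b < ℓ ∧ ℓ.Prime ∧ ¬ ℓ ∣ N ∧ ¬ ((ℓ : ℤ) ∣ NumberField.discr K) ∧ ℓ ≠ p ∧
      (Ideal.span {(ℓ : 𝓞 K)}).IsPrime ∧ FrobEqFrobInfty W K (p ^ M) ℓ ∧
      ∀ i, ∀ v : HeightOneSpectrum (𝓞 K), (ℓ : 𝓞 K) ∈ v.asIdeal →
        ((p : ℤ) ^ Nv i) • xs i ∈
            (W.baseChange K).torsionLocalKer (v.adicCompletion K) ((p ^ M : ℕ) : ℤ) ∧
          (Nv i ≠ 0 → ((p : ℤ) ^ (Nv i - 1)) • xs i ∉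
            (W.baseChange K).torsionLocalKer (v.adicCompletion K) ((p ^ M : ℕ) : ℤ)) := by
  have hpr : p.Prime := hp.out
  have hp2 : p ≠ 2 := by omega
  have hinv : ∀ y, (absGaloisTransport (K := ℚ) (L := K) c₀).toRingEquiv
      ((absGaloisTransport (K := ℚ) (L := K) c₀).toRingEquiv y) = y := fun y ↦
    RatClosure.absGaloisTransport_absGaloisTransport_of_sq_eq_one hc₀.sq_eq_one y
  -- a top value for each class with `e i > 0`
  have htop : ∀ i, 0 < e i → ∃ ρ ∈ torsionFixing (W.baseChange K) ((p ^ M : ℕ) : ℤ),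
      (μ ^ (e i - 1)) (((RatClosure.torsionEquiv (K := K) W ((p ^ M : ℕ) : ℤ)).symm
        (h1Eval (W.baseChange K) ((p ^ M : ℕ) : ℤ) (xs i) ρ)) : W.geomPoints) ≠ 0 := by
    intro i hei
    by_contra hall
    push Not at hall
    have h1 := hind (Pi.single i 1) (fun ρ hρ ↦ by
      rw [Finset.sum_eq_single i (fun j _ hj ↦ by rw [Pi.single_eq_of_ne hj, zero_smul])
        (fun h ↦ absurd (Finset.mem_univ i) h), Pi.single_eq_same, one_smul]
      exact hall ρ hρ) i hei
    rw [Pi.single_eq_same] at h1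
    exact hpr.one_lt.ne' (by exact_mod_cast Int.eq_one_of_dvd_one (Int.natCast_nonneg p) h1)
  -- the targets: `0` where `N_i = 0`, else a `ν_i`-eigenvector of exact depth `d_i` with `⌈d_i/2⌉ = N_i`,
  -- `d_i = 2N_i − 1` for sign `η`, `d_i = 2N_i` for sign `−η`
  have htarget : ∀ i, ∃ T : geomTorsion (W.baseChange K) ((p ^ M : ℕ) : ℤ),
      (μ ^ e i) (((RatClosure.torsionEquiv (K := K) W ((p ^ M : ℕ) : ℤ)).symm T :
        W.geomTorsion ((p ^ M : ℕ) : ℤ)) : W.geomPoints) = 0 ∧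
      ht.torsionMap W ((p ^ M : ℕ) : ℤ) T = ν i • T ∧
      ∀ a : ℕ, ((p : ℤ) ^ a) • T = 0 ↔ Nv i ≤ a := by
    intro i
    by_cases hNi : Nv i = 0
    · refine ⟨0, by rw [map_zero, ZeroMemClass.coe_zero, map_zero], by rw [map_zero, smul_zero],
        fun a ↦ ?_⟩
      rw [smul_zero, hNi]
      exact ⟨fun _ ↦ Nat.zero_le a, fun _ ↦ rfl⟩
    -- `N_i ≥ 1`: the requested depth by sign
    have hcase : (ν i = η ∧ 2 * Nv i ≤ e i + 1) ∨ (ν i = -η ∧ 2 * Nv i ≤ e i) := by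
      rcases hreq i with h | h | h
      · exact absurd h hNi
      · exact Or.inl h
      · exact Or.inr h
    set d : ℕ := if ν i = η then 2 * Nv i - 1 else 2 * Nv i with hd
    have hd1 : 1 ≤ d := by
      rw [hd]; split_ifs <;> omega
    have hde : d ≤ e i := by
      rw [hd]; split_ifs with h
      · rcases hcase with h' | h'
        · omega
        · exfalso
          rcases hηs with rfl | rfl <;> simp_all
      · rcases hcase with h' | h'
        · exact absurd h'.1 h
        · omega
    have hdN : (d + 1) / 2 = Nv i := by
      rw [hd]; split_ifs <;> omega
    have hpar : (-1 : ℤ) ^ (d - 1) * η = ν i := by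
      rw [hd]; split_ifs with h
      · rw [h, show 2 * Nv i - 1 - 1 = 2 * (Nv i - 1) by omega, pow_mul, neg_one_sq, one_pow, one_mul]
      · have hν' : ν i = -η := by
          rcases hcase with h' | h'
          · exact absurd h'.1 h
          · exact h'.1
        rw [hν', show 2 * Nv i - 1 = 2 * (Nv i - 1) + 1 by omega, pow_succ, pow_mul, neg_one_sq, one_pow,
          one_mul, neg_one_mul]
    have hei : 0 < e i := by omega
    obtain ⟨ρ₁, hρ₁, hρ₁top⟩ := htop i hei
    -- `t₀` of exact depth `d` from the top value
    set X : W.geomPoints := (((RatClosure.torsionEquiv (K := K) W ((p ^ M : ℕ) : ℤ)).symm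
      (h1Eval (W.baseChange K) ((p ^ M : ℕ) : ℤ) (xs i) ρ₁)) : W.geomPoints) with hX
    have hX_M : X ∈ W.geomTorsion ((p ^ M : ℕ) : ℤ) :=
      ((RatClosure.torsionEquiv (K := K) W ((p ^ M : ℕ) : ℤ)).symm
        (h1Eval (W.baseChange K) ((p ^ M : ℕ) : ℤ) (xs i) ρ₁)).2
    have ht₀M : (μ ^ (e i - d)) X ∈ W.geomTorsion ((p ^ M : ℕ) : ℤ) :=
      pow_apply_mem_geomTorsion W _ hX_M
    have ht₀d : (μ ^ d) ((μ ^ (e i - d)) X) = 0 := by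
      change (μ ^ d * μ ^ (e i - d)) X = 0
      rw [← pow_add, show d + (e i - d) = e i by omega]
      exact he i _ hρ₁
    have ht₀d' : (μ ^ (d - 1)) ((μ ^ (e i - d)) X) ≠ 0 := by
      change (μ ^ (d - 1) * μ ^ (e i - d)) X ≠ 0
      rw [← pow_add, show d - 1 + (e i - d) = e i - 1 by omega]
      exact hρ₁top
    obtain ⟨t, htM, hteig, htd, htd'⟩ := exists_eigen_exactDepth W p hc₀ hs hanti hp2 hηs hη hd1
      ht₀M ht₀d ht₀d'
    have hteig' : c₀ • t = ν i • t := by rw [hteig, hpar]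
    refine ⟨(RatClosure.torsionEquiv (K := K) W ((p ^ M : ℕ) : ℤ)) ⟨t, htM⟩, ?_, ?_, fun a ↦ ?_⟩
    · rw [(RatClosure.torsionEquiv (K := K) W ((p ^ M : ℕ) : ℤ)).symm_apply_apply]
      exact (pow_apply_eq_zero_iff_le W htd (Or.inr htd') (e i)).mpr hde
    · rw [← RatClosure.torsionEquiv_smul_of_lift W ht c₀ (fun _ ↦ rfl) ((p ^ M : ℕ) : ℤ) ⟨t, htM⟩,
        ← map_zsmul]
      congr 1
      exact Subtype.ext (by
        change c₀ • t = ((ν i • (⟨t, htM⟩ : W.geomTorsion ((p ^ M : ℕ) : ℤ)) :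
          W.geomTorsion ((p ^ M : ℕ) : ℤ)) : W.geomPoints)
        rw [AddSubgroupClass.coe_zsmul]; exact hteig')
    · rw [← map_zsmul, AddEquiv.map_eq_zero_iff,
        show (((p : ℤ) ^ a) • (⟨t, htM⟩ : W.geomTorsion ((p ^ M : ℕ) : ℤ)) = 0) ↔
          ((p : ℤ) ^ a) • t = 0 from
          ⟨fun h ↦ by
              have h' := congrArg Subtype.val h
              rw [AddSubgroupClass.coe_zsmul, ZeroMemClass.coe_zero] at h'
              exact h',
            fun h ↦ Subtype.ext (by rw [AddSubgroupClass.coe_zsmul, ZeroMemClass.coe_zero]; exact h)⟩,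
        pow_zsmul_eq_zero_iff_le_two_mul W p hm hμμ htd (Or.inr htd') a]
      omega
  choose T hTe hTν hTord using htarget
  -- FILE 1: realiser + Kolyvagin prime with kernel = kernel of `[·, ρ]`
  obtain ⟨ρ, hρT, hρt, ℓ, hbℓ, hℓ, hℓN, hℓD, hℓp, hprime, hfrob, hloc⟩ :=
    exists_kolyvaginPrime_gt_pow_kernel_of_cmRamified W p K hC (N := N) hCM h5 hram hs hm hμμ hcomm
      hK hM hc₀ ht hinv xs hxs e he hind T hTe hTν b
  refine ⟨ℓ, hbℓ, hℓ, hℓN, hℓD, hℓp, hprime, hfrob, fun i v hv ↦ ?_⟩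
  have hmem : ∀ a : ℕ, ((p : ℤ) ^ a) • xs i ∈ AddSubgroup.closure (Set.range xs) := fun a ↦
    AddSubgroup.zsmul_mem _ (AddSubgroup.subset_closure (Set.mem_range_self i)) _
  have hkey : ∀ a : ℕ, ((p : ℤ) ^ a) • xs i ∈
      (W.baseChange K).torsionLocalKer (v.adicCompletion K) ((p ^ M : ℕ) : ℤ) ↔ Nv i ≤ a := by
    intro a
    rw [hloc _ (hmem a) v hv, h1Eval_zsmul _ _ _ _ hρT, hρt i, hTord]
  exact ⟨(hkey _).mpr le_rfl, fun hNi h ↦ by have := (hkey _).mp h; omega⟩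

/-- **Shape (B2) on `H¹(K, W[p^M])`: an `η`-class and a `(−η)`-class jointly, NO independence hypothesis.**
For two `c_*`-eigenclasses `y` (sign `η`, values killed by `μ^{e_y}`, a non-zero top, `e_y ≥ 1`) and `z`
(sign `−η`, likewise `e_z ≥ 1`) and requests `2N_y ≤ e_y + 1`, `2N_z ≤ e_z` (either may be `0`), above every
`b` there is a Kolyvagin prime `ℓ` of level `p^M` with `ord y_λ = p^{N_y}` and `ord z_λ = p^{N_z}` (in the
kernel form). Top-layer independence of `{y, z}` is automatic (`hind_pair_of_opposite_sign`: opposite signs).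
This is the displayed hypothesis `hceb2` of `…BorelDescentClaimA` (Claim A's request). [cite: McCallumLMS1991, §3 Cor. 3.2] -/
theorem exists_kolyvaginPrime_gt_pow_requests_pair_of_opposite_sign
    (hC : Literature.NumberTheory.Automorphic.chebotarev_artinRep) {N : ℕ} [NeZero N]
    (hCM : W.HasCM) (h5 : 5 ≤ p) (hram : CMRamified W p)
    {s : AlgebraicClosure ℚ} {μ : AddMonoid.End W.geomPoints} {m : ℤ}
    (hs : s ^ 2 = ((-(p : ℤ) : ℤ) : AlgebraicClosure ℚ)) (hm : m.natAbs = p)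
    (hμμ : ∀ P, μ (μ P) = m • P)
    (hcomm : ∀ g : absoluteGaloisGroup ℚ, g • s = s → ∀ P, μ (g • P) = g • μ P)
    (hanti : ∀ g : absoluteGaloisGroup ℚ, g • s = -s → ∀ P, μ (g • P) = -(g • μ P))
    (hK : IsImaginaryQuadratic K) (hKp : ∀ y : K, y ^ 2 ≠ -(p : K)) {M : ℕ} (hM : 1 ≤ M)
    {c : K ≃ₐ[ℚ] K} {c₀ : absoluteGaloisGroup ℚ} (hc₀ : IsComplexConjugation (Rat.castHom ℝ) c₀)
    (ht : IsLiftOfAut c (absGaloisTransport (K := ℚ) (L := K) c₀).toRingEquiv)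
    {η : ℤ} (hηs : η = 1 ∨ η = -1) (hη : ∀ P : W.geomPoints, μ P = 0 → c₀ • P = η • P)
    {y z : galH1Torsion (W.baseChange K) ((p ^ M : ℕ) : ℤ)}
    (hy : conjAct W c ((p ^ M : ℕ) : ℤ) y = η • y) (hz : conjAct W c ((p ^ M : ℕ) : ℤ) z = (-η) • z)
    {ey ez : ℕ} (hey : 0 < ey) (hez : 0 < ez)
    (hye : ∀ ρ ∈ torsionFixing (W.baseChange K) ((p ^ M : ℕ) : ℤ),
      (μ ^ ey) ((RatClosure.torsionEquiv (K := K) W ((p ^ M : ℕ) : ℤ)).symm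
        (h1Eval (W.baseChange K) ((p ^ M : ℕ) : ℤ) y ρ) : W.geomPoints) = 0)
    (hze : ∀ ρ ∈ torsionFixing (W.baseChange K) ((p ^ M : ℕ) : ℤ),
      (μ ^ ez) ((RatClosure.torsionEquiv (K := K) W ((p ^ M : ℕ) : ℤ)).symm
        (h1Eval (W.baseChange K) ((p ^ M : ℕ) : ℤ) z ρ) : W.geomPoints) = 0)
    (hytop : ∃ ρ ∈ torsionFixing (W.baseChange K) ((p ^ M : ℕ) : ℤ),
      (μ ^ (ey - 1)) ((RatClosure.torsionEquiv (K := K) W ((p ^ M : ℕ) : ℤ)).symm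
        (h1Eval (W.baseChange K) ((p ^ M : ℕ) : ℤ) y ρ) : W.geomPoints) ≠ 0)
    (hztop : ∃ ρ ∈ torsionFixing (W.baseChange K) ((p ^ M : ℕ) : ℤ),
      (μ ^ (ez - 1)) ((RatClosure.torsionEquiv (K := K) W ((p ^ M : ℕ) : ℤ)).symm
        (h1Eval (W.baseChange K) ((p ^ M : ℕ) : ℤ) z ρ) : W.geomPoints) ≠ 0)
    {Ny Nz : ℕ} (hNy : 2 * Ny ≤ ey + 1) (hNz : 2 * Nz ≤ ez) (b : ℕ) :
    ∃ ℓ : ℕ, b < ℓ ∧ ℓ.Prime ∧ ¬ ℓ ∣ N ∧ ¬ ((ℓ : ℤ) ∣ NumberField.discr K) ∧ ℓ ≠ p ∧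
      (Ideal.span {(ℓ : 𝓞 K)}).IsPrime ∧ FrobEqFrobInfty W K (p ^ M) ℓ ∧
      ∀ v : HeightOneSpectrum (𝓞 K), (ℓ : 𝓞 K) ∈ v.asIdeal →
        (((p : ℤ) ^ Ny) • y ∈ (W.baseChange K).torsionLocalKer (v.adicCompletion K) ((p ^ M : ℕ) : ℤ) ∧
          (Ny ≠ 0 → ((p : ℤ) ^ (Ny - 1)) • y ∉
            (W.baseChange K).torsionLocalKer (v.adicCompletion K) ((p ^ M : ℕ) : ℤ))) ∧
        (((p : ℤ) ^ Nz) • z ∈ (W.baseChange K).torsionLocalKer (v.adicCompletion K) ((p ^ M : ℕ) : ℤ) ∧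
          (Nz ≠ 0 → ((p : ℤ) ^ (Nz - 1)) • z ∉
            (W.baseChange K).torsionLocalKer (v.adicCompletion K) ((p ^ M : ℕ) : ℤ))) := by
  have hp2 : p ≠ 2 := by have := hp.out.two_le; omega
  have hxs : ∀ i : Fin 2, conjAct W c ((p ^ M : ℕ) : ℤ) (![y, z] i) = (![η, -η] : Fin 2 → ℤ) i • ![y, z] i :=
    fun i ↦ by
    fin_cases i
    · exact hy
    · exact hz
  have he : ∀ i : Fin 2, ∀ ρ ∈ torsionFixing (W.baseChange K) ((p ^ M : ℕ) : ℤ),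
      (μ ^ (![ey, ez] : Fin 2 → ℕ) i) ((RatClosure.torsionEquiv (K := K) W ((p ^ M : ℕ) : ℤ)).symm
        (h1Eval (W.baseChange K) ((p ^ M : ℕ) : ℤ) (![y, z] i) ρ) : W.geomPoints) = 0 := fun i ↦ by
    fin_cases i
    · exact hye
    · exact hze
  have hind := hind_pair_of_opposite_sign W p hs hm hμμ hanti hp2 hKp hc₀ ht hηs hη ((p ^ M : ℕ) : ℤ)
    hηs hy hz hey hez hye hze hytop hztop
  obtain ⟨ℓ, hbℓ, hℓ, hℓN, hℓD, hℓp, hprime, hfrob, hloc⟩ :=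
    exists_kolyvaginPrime_gt_pow_requests_of_cmRamified W p hC (N := N) hCM h5 hram hs hm hμμ hcomm hanti
      hK hM hc₀ ht hηs hη ![y, z] hxs ![ey, ez] he (fun a ha i _ ↦ hind a ha i) ![Ny, Nz]
      (fun i ↦ by
        fin_cases i
        · exact Or.inr (Or.inl ⟨rfl, hNy⟩)
        · exact Or.inr (Or.inr ⟨rfl, hNz⟩)) b
  exact ⟨ℓ, hbℓ, hℓ, hℓN, hℓD, hℓp, hprime, hfrob, fun v hv ↦ ⟨hloc 0 v hv, hloc 1 v hv⟩⟩

/-- **Shape (B1) on `H¹(K, W[p^M])`: one eigenclass, any sign.** For a `c_*`-eigenclass `y` of sign `ν = ±1`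
with values killed by `μ^{e}`, a non-zero top (`e ≥ 1`), and a request `N` with `2N ≤ e + 1` if `ν = η`,
`2N ≤ e` if `ν = −η`: above every `b` a Kolyvagin prime with `ord y_λ = p^N`. (Top-layer independence of a
single class with a non-zero top is trivial.) This is `hceb1` of `…BorelDescentClaimB`. [cite: McCallumLMS1991, §3 Cor. 3.2] -/
theorem exists_kolyvaginPrime_gt_pow_requests_single
    (hC : Literature.NumberTheory.Automorphic.chebotarev_artinRep) {N : ℕ} [NeZero N]
    (hCM : W.HasCM) (h5 : 5 ≤ p) (hram : CMRamified W p)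
    {s : AlgebraicClosure ℚ} {μ : AddMonoid.End W.geomPoints} {m : ℤ}
    (hs : s ^ 2 = ((-(p : ℤ) : ℤ) : AlgebraicClosure ℚ)) (hm : m.natAbs = p)
    (hμμ : ∀ P, μ (μ P) = m • P)
    (hcomm : ∀ g : absoluteGaloisGroup ℚ, g • s = s → ∀ P, μ (g • P) = g • μ P)
    (hanti : ∀ g : absoluteGaloisGroup ℚ, g • s = -s → ∀ P, μ (g • P) = -(g • μ P))
    (hK : IsImaginaryQuadratic K) {M : ℕ} (hM : 1 ≤ M)
    {c : K ≃ₐ[ℚ] K} {c₀ : absoluteGaloisGroup ℚ} (hc₀ : IsComplexConjugation (Rat.castHom ℝ) c₀)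
    (ht : IsLiftOfAut c (absGaloisTransport (K := ℚ) (L := K) c₀).toRingEquiv)
    {η : ℤ} (hηs : η = 1 ∨ η = -1) (hη : ∀ P : W.geomPoints, μ P = 0 → c₀ • P = η • P)
    {y : galH1Torsion (W.baseChange K) ((p ^ M : ℕ) : ℤ)} {ν : ℤ}
    (hy : conjAct W c ((p ^ M : ℕ) : ℤ) y = ν • y) {ey : ℕ}
    (hye : ∀ ρ ∈ torsionFixing (W.baseChange K) ((p ^ M : ℕ) : ℤ),
      (μ ^ ey) ((RatClosure.torsionEquiv (K := K) W ((p ^ M : ℕ) : ℤ)).symm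
        (h1Eval (W.baseChange K) ((p ^ M : ℕ) : ℤ) y ρ) : W.geomPoints) = 0)
    (hytop : ∃ ρ ∈ torsionFixing (W.baseChange K) ((p ^ M : ℕ) : ℤ),
      (μ ^ (ey - 1)) ((RatClosure.torsionEquiv (K := K) W ((p ^ M : ℕ) : ℤ)).symm
        (h1Eval (W.baseChange K) ((p ^ M : ℕ) : ℤ) y ρ) : W.geomPoints) ≠ 0)
    {Ny : ℕ} (hNy : (ν = η ∧ 2 * Ny ≤ ey + 1) ∨ (ν = -η ∧ 2 * Ny ≤ ey)) (b : ℕ) :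
    ∃ ℓ : ℕ, b < ℓ ∧ ℓ.Prime ∧ ¬ ℓ ∣ N ∧ ¬ ((ℓ : ℤ) ∣ NumberField.discr K) ∧ ℓ ≠ p ∧
      (Ideal.span {(ℓ : 𝓞 K)}).IsPrime ∧ FrobEqFrobInfty W K (p ^ M) ℓ ∧
      ∀ v : HeightOneSpectrum (𝓞 K), (ℓ : 𝓞 K) ∈ v.asIdeal →
        ((p : ℤ) ^ Ny) • y ∈ (W.baseChange K).torsionLocalKer (v.adicCompletion K) ((p ^ M : ℕ) : ℤ) ∧
          (Ny ≠ 0 → ((p : ℤ) ^ (Ny - 1)) • y ∉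
            (W.baseChange K).torsionLocalKer (v.adicCompletion K) ((p ^ M : ℕ) : ℤ)) := by
  obtain ⟨ρ₀, hρ₀, hρ₀top⟩ := hytop
  -- independence of a one-member family: `a • top = 0` with `top ≠ 0` of order `p`
  have hind : ∀ a : Fin 1 → ℤ,
      (∀ ρ ∈ torsionFixing (W.baseChange K) ((p ^ M : ℕ) : ℤ),
        ∑ i, a i • (μ ^ ((![ey] : Fin 1 → ℕ) i - 1))
          ((RatClosure.torsionEquiv (K := K) W ((p ^ M : ℕ) : ℤ)).symm
            (h1Eval (W.baseChange K) ((p ^ M : ℕ) : ℤ) (![y] i) ρ) : W.geomPoints) = 0) →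
        ∀ i, 0 < (![ey] : Fin 1 → ℕ) i → (p : ℤ) ∣ a i := by
    intro a ha i _
    fin_cases i
    have h := ha ρ₀ hρ₀
    rw [Fin.sum_univ_one] at h
    exact prime_dvd_of_zsmul_eq_zero p hp.out hρ₀top
      (prime_zsmul_eq_zero_of_apply_eq_zero W p hm hμμ (apply_top_eq_zero W (hye ρ₀ hρ₀))) h
  obtain ⟨ℓ, hbℓ, hℓ, hℓN, hℓD, hℓp, hprime, hfrob, hloc⟩ :=
    exists_kolyvaginPrime_gt_pow_requests_of_cmRamified W p hC (N := N) hCM h5 hram hs hm hμμ hcomm hanti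
      hK hM hc₀ ht hηs hη ![y] (ν := ![ν])
      (fun i ↦ by fin_cases i; exact hy) ![ey] (fun i ↦ by fin_cases i; exact hye) hind ![Ny]
      (fun i ↦ by fin_cases i; exact Or.inr hNy) b
  exact ⟨ℓ, hbℓ, hℓ, hℓN, hℓD, hℓp, hprime, hfrob, fun v hv ↦ hloc 0 v hv⟩

end Summit.BirchSwinnertonDyer.BirchSwinnertonDyer.Theorems.PrintCFram.BorelKolyvaginPairing

end
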